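import Summits.NavierStokesRegularity.NavierStokesRegularity.Theses.PlaneEnergyCeiling
import Summits.NavierStokesRegularity.NavierStokesRegularity.Theorems.PlaneEnergyCeilingPlanarEnergyLiouvilleMeanDissipation
import Summits.NavierStokesRegularity.NavierStokesRegularity.Theorems.FrozenSignCascadeBoundedEnvelopeContinuationLiouvilleMorreyOfNoLocalTypeI
import HarnessLib

/-!
# Route PlaneEnergyCeiling · crux `PlanarEnergyLiouville` (stmt-NavierStokesRegularity-16856)
# ⇐ the Morrey–Liouville statement (L_M) ⇐ no local Type I singularity

Theorems file for the crux item stmt-NavierStokesRegularity-16856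
(`Theses.PlaneEnergyCeiling.PlanarEnergyLiouville`). It sharpens the landed conditional
`planarEnergyLiouville_of_liouvilleConjectureNS` ((L) ⇒ crux): the crux already follows from the
Liouville conjecture RESTRICTED TO THE TYPE-I (MORREY) CLASS of Albritton–Barker, equivalently
(Albritton–Barker 2019, Thm 1.1) from the absence of local Type I singular points of suitable weak
solutions.

* `oseenMild_and_morrey_of_planar` — the transfer: a bounded ancient mild solution (`ν = 1`,
  duality form) with measurable slices, jointly smooth on `(−∞,0) × ℝ³`, whose planar energies
  are bounded on every plane and every slice, (i) obeys the scale-invariant Morrey bound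
  `∫_{B_r(y)} ‖v(t)‖² ≤ 2M r` (route support `ScaledEnergyOfPlanar`) and (ii) solves the Oseen
  integral equation `v(t) = e^{(t−s)Δ}v(s) − B¹ₛ(v,v)(t)` between all pairs `s < t < 0`
  (bounded weak form, KNSS Lemma 3.1, and the Morrey bound kills the parasitic drift:
  `HardyAncientLimit.oseenMild_of_boundedWeak_ancient`).
* `planarEnergyLiouville_of_liouvilleMorrey` — hence the Morrey–Liouville statement (L_M) of route
  `FrozenSignCascade` (bounded ancient mild + jointly smooth + Oseen-mild + Morrey ⇒ `v ≡ 0`)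
  implies `PlanarEnergyLiouville`.
* `planarEnergyLiouville_of_not_localTypeISingularityExists` — and so does
  `¬ LocalTypeISingularityExists` (Albritton–Barker 2019, Thm 1.1, first bullet: no suitable weak
  solution of the unforced unit-viscosity system has a Type I singular point), through the landed
  `BoundedEnvelope.stub_liouvilleMorreyOfNoLocalTypeI`.

Both results are CONDITIONAL (the hypotheses are open statements); they locate the crux strictly
inside the Type-I exclusion problem: `¬ LocalTypeISingularityExists ⇒ (L_M) ⇒ PlanarEnergyLiouville`.

## References

* D. Albritton, T. Barker, J. Math. Fluid Mech. 21 (2019) = arXiv:1811.00502, Thm 1.1, §3.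
  [AlbrittonBarker2019]
* G. Koch, N. Nadirashvili, G. Seregin, V. Šverák, Acta Math. 203 (2009) = arXiv:0709.3599,
  Lemma 3.1, §4. [KochNadirashviliSereginSverak2009]
-/

-- Sub = summit for this single-conjunct summit: the duplicate namespace component is deliberate.
set_option linter.dupNamespace false

noncomputable section

open MeasureTheory Set Filter Metric Function Real
open _root_.Topology
open scoped ENNReal NNReal
open Literature.Analysis Literature.Analysis.FluidPDE

namespace Summit.NavierStokesRegularity.NavierStokesRegularity.Theorems.PlaneEnergyCeilingPlanarEnergyLiouville

/-- **Transfer to the Type-I class.** A bounded ancient mild solution (`ν = 1`) with measurable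
slices, jointly smooth on `(−∞,0) × ℝ³`, whose planar energies are bounded on every plane and
every slice, solves the Oseen integral equation between all pairs of negative times and obeys the
Morrey bound `∫_{B_r(y)} ‖v(t)‖² ≤ M' r` at every slice, centre and radius.
[cite: KochNadirashviliSereginSverak2009, Lemma 3.1 and §4; AlbrittonBarker2019, §3] -/
theorem oseenMild_and_morrey_of_planar {v : ℝ → EuclideanSpace ℝ (Fin 3) → EuclideanSpace ℝ (Fin 3)}
    (hv : IsBoundedAncientMildSolution 1 v)
    (hmeas : ∀ t < 0, AEStronglyMeasurable (v t) volume)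
    (hsm : ContDiffOn ℝ (⊤ : ℕ∞) (uncurry v) (Iio 0 ×ˢ univ))
    (hpl : ∃ M : ℝ, ∀ t < 0, ∀ (R : EuclideanSpace ℝ (Fin 3) ≃ₗᵢ[ℝ] EuclideanSpace ℝ (Fin 3)) (c : ℝ),
      ∫⁻ y : EuclideanSpace ℝ (Fin 2), ‖v t (R (WithLp.toLp 2 ![y 0, y 1, c]))‖ₑ ^ 2 ≤ ENNReal.ofReal M) :
    (∀ s t : ℝ, s < t → t < 0 → ∀ x,
        v t x = UnboundedOperators.heatExtension (v s) (t - s) x - oseenDuhamel 1 s v v t x) ∧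
      ∃ M' : ℝ, ∀ t < 0, ∀ (y : EuclideanSpace ℝ (Fin 3)) (r : ℝ), 0 < r →
        ∫ x in Metric.ball y r, ‖v t x‖ ^ 2 ≤ M' * r := by
  obtain ⟨M₀, hM₀⟩ := hpl
  set M : ℝ := max M₀ 0 with hMdef
  have hM : 0 ≤ M := le_max_right _ _
  have hcont : ContinuousOn (uncurry v) (Iio 0 ×ˢ univ) := hsm.continuousOn
  have hslice : ∀ t < 0, Continuous (v t) := fun t ht =>
    (contDiff_slice_of_contDiffOn hsm (show t ∈ Iio 0 from ht)).continuous
  have hplM : ∀ t < 0, ∀ (R : EuclideanSpace ℝ (Fin 3) ≃ₗᵢ[ℝ] EuclideanSpace ℝ (Fin 3)) (c : ℝ),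
      ∫⁻ y : EuclideanSpace ℝ (Fin 2), ‖v t (R (WithLp.toLp 2 ![y 0, y 1, c]))‖ₑ ^ 2 ≤ ENNReal.ofReal M :=
    fun t ht R c => (hM₀ t ht R c).trans (ENNReal.ofReal_le_ofReal (le_max_left _ _))
  obtain ⟨V₀, hV₀⟩ := hv.2
  have hbd : ∀ t < 0, ∀ x, ‖v t x‖ ≤ V₀ := fun t ht x => hV₀ t ht x
  -- the Morrey bound
  have hMorE : ∀ t < 0, ∀ (y : EuclideanSpace ℝ (Fin 3)) (r : ℝ), 0 < r →
      ∫⁻ x in ball y r, ‖v t x‖ₑ ^ 2 ≤ ENNReal.ofReal (2 * r * M) := fun t ht y r hr =>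
    PlanarEnergyAPriori.planeEnergyCeiling_scaledEnergyOfPlanar (v t) (hslice t ht) M hM
      (hplM t ht) y r hr
  have hMor : ∀ t < 0, ∀ (y : EuclideanSpace ℝ (Fin 3)) (r : ℝ), 0 < r →
      ∫ x in ball y r, ‖v t x‖ ^ 2 ≤ 2 * M * r := fun t ht y r hr =>
    integral_ball_sq_le_of_lintegral_le (hslice t ht) hM hr (hMorE t ht y r hr)
  have hMorN : ∀ t < 0, ∀ m : ℕ, 1 ≤ m →
      ∫⁻ y in ball (0 : EuclideanSpace ℝ (Fin 3)) m, ‖v t y‖ₑ ^ 2 ≤ ENNReal.ofReal (2 * M * m) := by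
    intro t ht m hm
    have hm0 : (0 : ℝ) < m := by exact_mod_cast hm
    have := hMorE t ht 0 m hm0
    rwa [mul_right_comm] at this
  -- bounded weak, Oseen-mild
  have hjm : AEStronglyMeasurable (uncurry v)
      ((volume : Measure (ℝ × EuclideanSpace ℝ (Fin 3))).restrict (Iio 0 ×ˢ univ)) :=
    hcont.aestronglyMeasurable (measurableSet_Iio.prod MeasurableSet.univ)
  have hweak := hv.isBoundedWeakNSSolutionOn one_pos hjm hmeas
  have hoseen := (HardyAncientLimit.oseenMild_of_boundedWeak_ancient hweak hcont hbd
    (I := 2 * M) (by positivity) (m₀ := 1) hMorN).2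
  exact ⟨hoseen, 2 * M, hMor⟩

/-- **`PlanarEnergyLiouville` ⇐ the Morrey–Liouville statement (L_M)** (conditional proof of the
crux item stmt-NavierStokesRegularity-16856): if every bounded ancient mild solution (`ν = 1`),
jointly smooth and Oseen-mild on `(−∞,0) × ℝ³`, with the scale-invariant Morrey bound at all
radii vanishes identically — the Liouville conjecture of KNSS restricted to Albritton–Barker's
Type-I class —, then `PlanarEnergyLiouville` holds (`oseenMild_and_morrey_of_planar`).
[cite: AlbrittonBarker2019, §1 and Thm 1.1; KochNadirashviliSereginSverak2009, §1] -/
theorem planarEnergyLiouville_of_liouvilleMorrey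
    (hLM : ∀ v : ℝ → EuclideanSpace ℝ (Fin 3) → EuclideanSpace ℝ (Fin 3),
      IsBoundedAncientMildSolution 1 v →
      ContDiffOn ℝ (⊤ : ℕ∞) (uncurry v) (Set.Iio 0 ×ˢ Set.univ) →
      (∀ s t : ℝ, s < t → t < 0 → ∀ x,
        v t x = UnboundedOperators.heatExtension (v s) (t - s) x - oseenDuhamel 1 s v v t x) →
      (∃ M' : ℝ, ∀ t < 0, ∀ (y : EuclideanSpace ℝ (Fin 3)) (r : ℝ), 0 < r →
        ∫ x in Metric.ball y r, ‖v t x‖ ^ 2 ≤ M' * r) →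
      ∀ t < 0, ∀ x, v t x = 0) :
    Summit.NavierStokesRegularity.NavierStokesRegularity.Theses.PlaneEnergyCeiling.PlanarEnergyLiouville := by
  intro v hv hmeas hsm hpl
  obtain ⟨hoseen, hMor⟩ := oseenMild_and_morrey_of_planar hv hmeas hsm hpl
  exact hLM v hv hsm hoseen hMor

/-- **`PlanarEnergyLiouville` ⇐ no local Type I singularity** (conditional proof of the crux item
stmt-NavierStokesRegularity-16856 from the open statement `¬ LocalTypeISingularityExists`,
Albritton–Barker 2019, Thm 1.1, first bullet): composition of
`planarEnergyLiouville_of_liouvilleMorrey` with the landed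
`BoundedEnvelope.stub_liouvilleMorreyOfNoLocalTypeI` (route `FrozenSignCascade`).
[cite: AlbrittonBarker2019, Thm 1.1] -/
theorem planarEnergyLiouville_of_not_localTypeISingularityExists
    (h : ¬ Literature.Analysis.FluidPDE.LocalTypeISingularityExists) :
    Summit.NavierStokesRegularity.NavierStokesRegularity.Theses.PlaneEnergyCeiling.PlanarEnergyLiouville :=
  planarEnergyLiouville_of_liouvilleMorrey (BoundedEnvelope.stub_liouvilleMorreyOfNoLocalTypeI h)

end Summit.NavierStokesRegularity.NavierStokesRegularity.Theorems.PlaneEnergyCeilingPlanarEnergyLiouville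

end
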